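import Mathlib
import HarnessLib
import Literature.AlgebraicGeometry.Resolution.Lipman1969RationalSurfaceSingularities
import Literature.AlgebraicGeometry.Resolution.ExceptionalCurvePoints
import Literature.AlgebraicGeometry.Resolution.ExceptionalFibreConnected
import Literature.AlgebraicGeometry.Resolution.ProperBirationalGlobalSections
import Literature.AlgebraicGeometry.Resolution.RankOneReductionProofs
import Literature.AlgebraicGeometry.Motives.CartierDivisor
import Summits.ResolutionOfSingularities.ResolutionOfSingularities.Theorems.HomologicalConductorNoZenoTowerNoetherian
import Summits.ResolutionOfSingularities.ResolutionOfSingularities.Theorems.HomologicalConductorNoZenoIffKernel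
import Summits.ResolutionOfSingularities.ResolutionOfSingularities.Theorems.HomologicalConductorNoZenoDim2RegularCentre
import Summits.ResolutionOfSingularities.ResolutionOfSingularities.Theorems.HomologicalConductorNoZenoClosedFibreDictionaryTower

/-!
# Route `HomologicalConductor`, kill test `SurfaceTermination` (stmt-ResolutionOfSingularities-16488):
# the CENTRE-RING DICTIONARY of one resolution of a stage, part 1: the local rings `𝒪_{X,x} ⊆ K`

OURS (cell res-hironaka, crux chain W4.4, seat res-L0-w44-stub-4; object named by res-L0-w44-plan-1 g12,
2026-08-27T09:17:11Z (c)); nothing here is a statement of the manuscript under review (Hironaka 2017);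
AI-written, weaker than expert review.  SUPPORT-level (kill test K4.4-s), mechanism-neutral: consumed by both
candidate (R2) mechanisms of K44S-DESCENT.

Let `T ⊆ K` be a `k`-subalgebra with `Frac T = K` and `π : X ⟶ Spec T` a resolution (more generally: `X`
integral, `π` birational and proper).  Zariski–Samuel's «points of a model as local rings of the function
field» (Commutative Algebra II, Ch. VI §17) for the `T`-model `X`, with the function field `K(X)`
identified with `K` over `T`:

* §1 the local rings `𝒪_{X,x} ⊆ K` (`((RatFn.toFunctionField x).range).map e`, `e : K(X) ≃ K` over `T`):
  membership, `T ⊆ 𝒪_{X,x}`, `𝒪_{X,x} ≅` the stalk (regular when `X` is), integrally closed in `K`,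
  essentially of finite type over `k` when `T` is;
* the closed-fibre criterion (`base_eq_closedPoint_of_forall_not_isUnit`, `base_eq_closedPoint_of_le`): if
  `𝒪_{X,x} ⊆ V` for a subring `V` relatively dominating `T`, then `x` lies in the closed fibre.
Part 2 (`…SurfaceTerminationCentres`): centres of valuation rings (valuative criterion), curve detection, and
the assembly `exists_centreRing_tower` = `stub_centreRing` of `DescentSketch.lean` verbatim.

Port to `T`-models of the tree's `ProjModel.stalkSubring` / `IsCentreOf` / `KModel.exists_isCentre`
(`Literature/AlgebraicGeometry/Resolution/ProjectiveModelsCentresLocal`, `ValuationCentre`), def-free.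

References: O. Zariski, P. Samuel, *Commutative Algebra* II (1960), Ch. VI §17 [`ZariskiSamuel1960`];
A. Grothendieck, EGA II (1961), 7.3.8 [`EGAII`]; J. Lipman, Publ. Math. IHÉS 36 (1969) §12 [`Lipman1969`].
-/

noncomputable section

-- single-problem summit: the doubled namespace component `ResolutionOfSingularities` is forced
set_option linter.dupNamespace false

namespace Summit.ResolutionOfSingularities.ResolutionOfSingularities.Theorems.SurfaceTermination.CentreRing

open CategoryTheory AlgebraicGeometry TopologicalSpace IsLocalRing
open Literature.AlgebraicGeometry.Resolution Literature.AlgebraicGeometry.Motives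
open Summit.ResolutionOfSingularities.ResolutionOfSingularities.Theorems.NoZeno.Birth
open Summit.ResolutionOfSingularities.ResolutionOfSingularities.Theorems.NoZeno.SandwichCluster

variable {k K : Type} [Field k] [Field K] [Algebra k K]

/-! ## §1 The local rings of `X` inside `K` -/

section StalkSubring

variable (T : Subalgebra k K) {X : Scheme.{0}} [IsIntegral X] (π : X ⟶ Spec (.of ↥T))
  (e : ↑X.functionField ≃+* K)

/-- Membership in `𝒪_{X,x} ⊆ K`. [folklore] -/
theorem mem_stalkSubring_iff (x : X) {z : K} :
    z ∈ ((RatFn.toFunctionField x).range).map e.toRingHom ↔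
      ∃ s : X.presheaf.stalk x, e (RatFn.toFunctionField x s) = z := by
  simp only [Subring.mem_map, RingHom.mem_range, RingEquiv.toRingHom_eq_coe, RingHom.coe_coe,
    exists_exists_eq_and]

/-- `𝒪_{X,x} → 𝒪_{X,x} ⊆ K` is injective-with-image: the codomain-restricted map is bijective, so
`𝒪_{X,x} ≅` its image in `K`. [cite: ZariskiSamuel1960, Ch. VI §17] -/
theorem bijective_codRestrict (x : X) :
    Function.Bijective ((e.toRingHom.comp (RatFn.toFunctionField x)).codRestrict
      (((RatFn.toFunctionField x).range).map e.toRingHom)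
      (fun s => (mem_stalkSubring_iff e x).mpr ⟨s, rfl⟩)) := by
  refine ⟨fun a b h => ?_, fun z => ?_⟩
  · have h' := congrArg Subtype.val h
    exact RatFn.toFunctionField_injective x (e.injective h')
  · obtain ⟨s, hs⟩ := (mem_stalkSubring_iff e x).mp z.2
    exact ⟨s, Subtype.ext hs⟩

/-- `𝒪_{X,x} ⊆ K` is a regular local ring when `X` is regular at `x`. [folklore] -/
theorem isRegularLocalRing_stalkSubring (x : X) [IsRegularLocalRing (X.presheaf.stalk x)] :
    IsRegularLocalRing ↥(((RatFn.toFunctionField x).range).map e.toRingHom) :=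
  IsRegularLocalRing.of_ringEquiv (RingEquiv.ofBijective _ (bijective_codRestrict e x))

variable (he : ∀ t : ↥T, e (baseToFunctionField π t) = (t : K))
include he

/-- `T ⊆ 𝒪_{X,x}`: an element `t ∈ T` is the germ at `x` of the global function `π^*(t)`.
[cite: ZariskiSamuel1960, Ch. VI §17] -/
theorem coe_mem_stalkSubring (x : X) (t : ↥T) :
    (t : K) ∈ ((RatFn.toFunctionField x).range).map e.toRingHom := by
  refine (mem_stalkSubring_iff e x).mpr
    ⟨X.presheaf.germ ⊤ x trivial (Literature.AlgebraicGeometry.Morphisms.algebraMapΓ π t), ?_⟩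
  rw [RatFn.toFunctionField_germ, ← he t]
  rfl

/-- `T ≤ 𝒪_{X,x}` as subrings of `K`. [folklore] -/
theorem toSubring_le_stalkSubring (x : X) :
    T.toSubring ≤ ((RatFn.toFunctionField x).range).map e.toRingHom :=
  fun t ht => coe_mem_stalkSubring T π e he x ⟨t, ht⟩

end StalkSubring


/-! ## §1b The closed-fibre criterion -/

section ClosedFibre

variable (T : Subalgebra k K) {X : Scheme.{0}} (π : X ⟶ Spec (.of ↥T))

/-- **Closed-fibre criterion.**  If no element of `𝔪_T` becomes a unit in `𝒪_{X,x}` then `x` lies over the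
closed point (`𝒪_{Spec T, π x} = T_{π x}` inverts everything outside `π x`). [folklore] -/
theorem base_eq_closedPoint_of_forall_not_isUnit [IsLocalRing ↥T] (x : X)
    (h : ∀ t ∈ maximalIdeal ↥T, ¬ IsUnit ((X.presheaf.germ ⊤ x trivial).hom
      (Literature.AlgebraicGeometry.Morphisms.algebraMapΓ π t))) :
    π.base x = closedPoint ↥T := by
  -- in `𝒪_{Spec T, y} = T_y`, `y = π x`: an element outside `y` is a unit, hence a unit at `x`
  set y := π.base x with hy
  letI : Algebra ↥T ((Spec (.of ↥T)).presheaf.stalk y) := StructureSheaf.stalkAlgebra (↥T) y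
  haveI : IsLocalization.AtPrime ((Spec (.of ↥T)).presheaf.stalk y) y.asIdeal :=
    StructureSheaf.IsLocalization.to_stalk (↥T) y
  have hle : maximalIdeal ↥T ≤ y.asIdeal := by
    intro t ht
    by_contra hty
    have hu : IsUnit (algebraMap ↥T ((Spec (.of ↥T)).presheaf.stalk y) t) :=
      IsLocalization.map_units _ (⟨t, hty⟩ : y.asIdeal.primeCompl)
    have hu' : IsUnit ((π.stalkMap x).hom (((Spec (.of ↥T)).presheaf.germ ⊤ (π.base x) trivial).hom
        ((Scheme.ΓSpecIso (.of ↥T)).inv.hom t))) := hu.map _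
    apply h t ht
    have hfac : (X.presheaf.germ ⊤ x trivial).hom (Literature.AlgebraicGeometry.Morphisms.algebraMapΓ π t) =
        (π.stalkMap x).hom (((Spec (.of ↥T)).presheaf.germ ⊤ (π.base x) trivial).hom
          ((Scheme.ΓSpecIso (.of ↥T)).inv.hom t)) := by
      rw [Scheme.Hom.germ_stalkMap_apply]
      rfl
    rw [hfac]
    exact hu'
  have heq : y.asIdeal = maximalIdeal ↥T :=
    (IsLocalRing.maximalIdeal.isMaximal ↥T).eq_of_le y.2.ne_top hle |>.symm
  exact PrimeSpectrum.ext heq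

end ClosedFibre

/-! ## §1c Integral closedness; domination puts `x` in the closed fibre -/

section Normal

variable (T : Subalgebra k K) {X : Scheme.{0}} [IsIntegral X] (π : X ⟶ Spec (.of ↥T))
  (e : ↑X.functionField ≃+* K) (he : ∀ t : ↥T, e (baseToFunctionField π t) = (t : K))
include he

/-- `𝒪_{X,x} ⊆ K` is integrally closed in `K` when `X` is regular at `x` and `Frac T = K`: a regular local
ring is a normal domain, and its fraction field is `K` (it contains `T`). Stated for any `k`-subalgebra `S`
with the same elements. [folklore] -/
theorem mem_of_isIntegral [IsFractionRing ↥T K] (x : X) [IsRegularLocalRing (X.presheaf.stalk x)]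
    (S : Subalgebra k K) (hS : S.toSubring = ((RatFn.toFunctionField x).range).map e.toRingHom)
    (y : K) (hy : IsIntegral ↥S y) : y ∈ S := by
  have hTS : T ≤ S := fun t ht => by
    have := toSubring_le_stalkSubring T π e he x (Subalgebra.mem_toSubring.mpr ht)
    rw [← hS] at this
    exact Subalgebra.mem_toSubring.mp this
  haveI : IsFractionRing ↥S K := isFractionRing_subalgebra_of_le T S hTS
  haveI : IsRegularLocalRing ↥S := by
    have h := isRegularLocalRing_stalkSubring e x
    have eqv : ↥(((RatFn.toFunctionField x).range).map e.toRingHom) ≃+* ↥S :=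
      (RingEquiv.subringCongr hS.symm).trans (RingEquiv.refl _)
    exact IsRegularLocalRing.of_ringEquiv eqv
  haveI : IsIntegrallyClosed ↥S := isIntegrallyClosed_of_isRegularLocalRing ↥S
  obtain ⟨y', hy'⟩ := (IsIntegrallyClosed.isIntegral_iff (R := ↥S) (K := K)).mp hy
  rw [← hy']
  exact y'.2

/-- If `𝒪_{X,x} ⊆ V` for a subring `V` of `K` which relatively dominates `T` (an element of `T` inverted in `V`
is inverted in `T`), then `x` lies in the closed fibre. [cite: ZariskiSamuel1960, Ch. VI §17] -/
theorem base_eq_closedPoint_of_le [IsLocalRing ↥T] (x : X) (V : Subring K)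
    (hxV : ((RatFn.toFunctionField x).range).map e.toRingHom ≤ V)
    (hdomT : ∀ t ∈ T, t⁻¹ ∈ V → t⁻¹ ∈ T) : π.base x = closedPoint ↥T := by
  refine base_eq_closedPoint_of_forall_not_isUnit T π x fun t ht hu => ?_
  -- the inverse germ gives `t⁻¹ ∈ 𝒪_{X,x} ⊆ V`, hence `t⁻¹ ∈ T`: `t` is a unit of `T`
  have ht0 : (t : K) ≠ 0 := by
    intro h0
    have : t = 0 := Subtype.ext h0
    rw [this, map_zero, map_zero] at hu
    exact not_isUnit_zero hu
  obtain ⟨u, hu'⟩ := hu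
  have hval : e (RatFn.toFunctionField x ↑u) = (t : K) := by
    rw [hu', RatFn.toFunctionField_germ, ← he t]; rfl
  have hinv : e (RatFn.toFunctionField x ↑u⁻¹) = (t : K)⁻¹ := by
    refine (eq_inv_of_mul_eq_one_left ?_)
    rw [← hval, ← map_mul, ← map_mul, Units.inv_mul, map_one, map_one]
  have hmem : (t : K)⁻¹ ∈ V := hxV ((mem_stalkSubring_iff e x).mpr ⟨_, hinv⟩)
  have htinv : (t : K)⁻¹ ∈ T := hdomT (t : K) t.2 hmem
  apply (IsLocalRing.mem_maximalIdeal _).mp ht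
  refine isUnit_iff_exists_inv.mpr ⟨⟨(t : K)⁻¹, htinv⟩, Subtype.ext ?_⟩
  exact mul_inv_cancel₀ ht0

end Normal


/-! ## §1d Essential finiteness over `k` -/

section EssFinite

variable (T : Subalgebra k K) {X : Scheme.{0}} [IsIntegral X] (π : X ⟶ Spec (.of ↥T))
  (e : ↑X.functionField ≃+* K) (he : ∀ t : ↥T, e (baseToFunctionField π t) = (t : K))
include he

/-- **`𝒪_{X,x} ⊆ K` is essentially of finite type over `k`** when `T` is and `π` is locally of finite
type: on an affine open `U ∋ x`, `Γ(U) = T[g₁,…,g_n]`, `𝒪_{X,x} = Γ(U)_𝔭`, so every element of `𝒪_{X,x} ⊆ K`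
is a fraction `c u⁻¹` with `c, u` in the `k`-algebra `k[T ∪ {gᵢ}]`, `u` a unit of `𝒪_{X,x}`
(`tn_essFiniteType_of_frac`). [folklore] -/
theorem essFiniteType_of [LocallyOfFiniteType π] (hT : Algebra.EssFiniteType k ↥T) (x : X)
    (S : Subalgebra k K) (hS : S.toSubring = ((RatFn.toFunctionField x).range).map e.toRingHom) :
    Algebra.EssFiniteType k ↥S := by
  classical
  have hmem : ∀ {z : K}, z ∈ S ↔ ∃ s : X.presheaf.stalk x, e (RatFn.toFunctionField x s) = z := by
    intro z
    rw [← Subalgebra.mem_toSubring, hS]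
    exact mem_stalkSubring_iff e x
  have hTS : T ≤ S := fun t ht => by
    have := toSubring_le_stalkSubring T π e he x (Subalgebra.mem_toSubring.mpr ht)
    rw [← hS] at this
    exact Subalgebra.mem_toSubring.mp this
  -- an affine open neighbourhood `U` of `x`; `Γ(U)` is of finite type over `T`
  obtain ⟨_, ⟨U, hU, rfl⟩, hxU, -⟩ :=
    X.isBasis_affineOpens.exists_subset_of_mem_open (Set.mem_univ x) isOpen_univ
  let φ : ↥T →+* Γ(X, U) := (π.appLE ⊤ U le_top).hom.comp (Scheme.ΓSpecIso (.of ↥T)).inv.hom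
  have hφ : φ.FiniteType := by
    refine RingHom.FiniteType.comp ?_ (RingHom.FiniteType.of_surjective _
      (Scheme.ΓSpecIso (.of ↥T)).commRingCatIsoToRingEquiv.symm.surjective)
    exact HasRingHomProperty.appLE @LocallyOfFiniteType π inferInstance ⟨⊤, isAffineOpen_top _⟩ ⟨U, hU⟩ le_top
  -- `ρ : Γ(U) → 𝒪_{X,x} → K`
  let ρ : Γ(X, U) →+* K :=
    (e : ↑X.functionField →+* K).comp ((RatFn.toFunctionField x).comp (X.presheaf.germ U x hxU).hom)
  have hρ : ∀ r, ρ r = e (RatFn.toFunctionField x ((X.presheaf.germ U x hxU).hom r)) := fun _ => rfl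
  have hρS : ∀ r, ρ r ∈ S := fun r => hmem.mpr ⟨_, (hρ r).symm⟩
  have hρφ : ∀ t : ↥T, ρ (φ t) = (t : K) := by
    intro t
    rw [hρ]
    have h1 : (X.presheaf.germ U x hxU).hom (φ t) =
        (X.presheaf.germ ⊤ x trivial).hom (Literature.AlgebraicGeometry.Morphisms.algebraMapΓ π t) := by
      change (X.presheaf.germ U x hxU).hom ((π.appLE ⊤ U le_top).hom _) = _
      rw [Scheme.Hom.appLE]
      simp only [CommRingCat.hom_comp, RingHom.comp_apply]
      rw [← CommRingCat.comp_apply, X.presheaf.germ_res]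
      rfl
    rw [h1, RatFn.toFunctionField_germ, ← he t]
    rfl
  -- generators of `Γ(U)` over `T`, their images `F ⊆ K`, and `C = k[T ∪ F]`
  letI : Algebra ↥T Γ(X, U) := φ.toAlgebra
  have hFT : Algebra.FiniteType ↥T Γ(X, U) := hφ
  obtain ⟨g, hg⟩ := hFT.out
  let F : Finset K := g.image ρ
  let C : Subalgebra k K := Algebra.adjoin k ((T : Set K) ∪ ↑F)
  have hC : Algebra.EssFiniteType k ↥C := tn_essFiniteType_adjoin_union T hT F
  have hρC : ∀ r : Γ(X, U), ρ r ∈ C := by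
    intro r
    have hr : r ∈ Algebra.adjoin ↥T (↑g : Set Γ(X, U)) := by rw [hg]; trivial
    induction hr using Algebra.adjoin_induction with
    | mem r' hr' =>
      refine Algebra.subset_adjoin (Or.inr ?_)
      simp only [F, Finset.coe_image]
      exact Set.mem_image_of_mem ρ hr'
    | algebraMap t =>
      rw [show algebraMap ↥T Γ(X, U) t = φ t from rfl, hρφ]
      exact Algebra.subset_adjoin (Or.inl t.2)
    | add a b _ _ ha hb => rw [map_add]; exact C.add_mem ha hb
    | mul a b _ _ ha hb => rw [map_mul]; exact C.mul_mem ha hb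
  have hCS : C ≤ S := by
    refine Algebra.adjoin_le (Set.union_subset (fun t ht => hTS ht) ?_)
    intro z hz
    simp only [F, Finset.coe_image] at hz
    obtain ⟨r, -, rfl⟩ := hz
    exact hρS r
  -- fractions: `𝒪_{X,x} = Γ(U)_𝔭`
  refine tn_essFiniteType_of_frac hCS hC fun z hz => ?_
  obtain ⟨sx, rfl⟩ := hmem.mp hz
  letI : Algebra Γ(X, U) (X.presheaf.stalk x) := (X.presheaf.germ U x hxU).hom.toAlgebra
  haveI : IsLocalization.AtPrime (X.presheaf.stalk x) (hU.primeIdealOf ⟨x, hxU⟩).asIdeal :=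
    hU.isLocalization_stalk ⟨x, hxU⟩
  obtain ⟨⟨a, b⟩, hab⟩ :=
    IsLocalization.surj (hU.primeIdealOf ⟨x, hxU⟩).asIdeal.primeCompl sx
  have halg : ∀ r, algebraMap Γ(X, U) (X.presheaf.stalk x) r = (X.presheaf.germ U x hxU).hom r :=
    fun _ => rfl
  have hbu : IsUnit ((X.presheaf.germ U x hxU).hom (b : Γ(X, U))) := by
    rw [← halg]; exact IsLocalization.map_units _ b
  obtain ⟨u, hu⟩ := hbu
  have hinjρ : ∀ r, ρ r = 0 → (X.presheaf.germ U x hxU).hom r = 0 := by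
    intro r hr
    rw [hρ, map_eq_zero_iff _ e.injective] at hr
    exact RatFn.toFunctionField_injective x (by rw [hr, map_zero])
  have hρb0 : ρ (b : Γ(X, U)) ≠ 0 := by
    intro h0
    have := hinjρ _ h0
    rw [← hu] at this
    exact u.ne_zero this
  have hinv : e (RatFn.toFunctionField x ↑u⁻¹) = (ρ (b : Γ(X, U)))⁻¹ := by
    refine (eq_inv_of_mul_eq_one_left ?_)
    rw [hρ, ← hu, ← map_mul, ← map_mul, Units.inv_mul, map_one, map_one]
  refine ⟨ρ a, hρC a, ρ (b : Γ(X, U)), hρC _, hρb0, hmem.mpr ⟨_, hinv⟩, ?_⟩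
  -- `z · ρ b = ρ a`
  have hab' : e (RatFn.toFunctionField x sx) * ρ (b : Γ(X, U)) = ρ a := by
    rw [hρ, hρ, ← map_mul, ← map_mul, ← halg, hab, halg]
  rw [← hab', mul_inv_cancel_right₀ hρb0]

end EssFinite

end Summit.ResolutionOfSingularities.ResolutionOfSingularities.Theorems.SurfaceTermination.CentreRing

end
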